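import Mathlib.Analysis.Analytic.Uniqueness
import Mathlib.Analysis.Analytic.Polynomial
import Mathlib.Analysis.Analytic.Linear
import Mathlib.Analysis.Complex.Basic
import Mathlib.Analysis.Calculus.Deriv.Basic
import Mathlib.RingTheory.MvPolynomial.Homogeneous
import Mathlib.Algebra.MvPolynomial.PDeriv
import Mathlib.Algebra.MvPolynomial.Monad
import Mathlib.RingTheory.GradedAlgebra.Radical
import Mathlib.RingTheory.Ideal.Maps
import Literature.RingTheory.MvPolynomial.BihomogeneousCoefficients
import Literature.NumberTheory.Transcendental.PkappaThetaAdditionPoly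
import HarnessLib

/-!
# Zero estimates on commutative algebraic groups, I: analytic group models and their Zariski topology

Topic `Literature/NumberTheory/Transcendental`. First module of the discharge of the named fact
`Literature.NumberTheory.Transcendental.philippon1986_std` (Philippon 1986, Théorème 2.1, for the
groups `M_κ = 𝔾ₘ^β × P_κ` in their theta embedding, `PhilipponZeroEstimateStd.lean`), following
D. Roy's exposition of Philippon's zero estimate for a general connected commutative algebraic
group `G ⊆ ℙ^N(ℂ)` (Nesterenko–Philippon (eds.), LNM 1752, Ch. 11, pp. 197–220; the tree's
`PhilipponZeroEstimate*.lean` is the same proof for the LINEAR group `𝔾ₐ × 𝔾ₘ^n`, where the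
coordinate ring is a polynomial ring).

We axiomatise the data the proof really uses as an **analytic group model** of a commutative
algebraic group: the Lie algebra `V` (a finite-dimensional complex normed space) with the
exponential map written in projective coordinates `Θ₀, …, Θ_N : V → ℂ` (entire, never
simultaneously zero), a *complete system of addition laws* in the sense of op. cit. §2.1, in the form
the theta model of `M_κ` provides them (`PkappaThetaAdditionPoly.lean`: polynomial in the first
argument, ANALYTIC in the second) — families `A^α = (A^α_I(X, v))_I` of forms of degree `c` in
`X` whose coefficients are entire functions of `v ∈ V`, with
`A^α_I(Θ(u), v) = λ^α(u, v) · Θ_I(u + v)` for an entire scalar factor `λ^α` and, for every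
`(u, v)`, some `λ^α(u, v) ≠ 0` (third version of the structure: the first two asked for laws
polynomial in both arguments, which is more than Roy's §3 uses) —, three algebraic completeness properties
of the embedding (surjectivity of `Θ` onto the quasi-projective variety it parametrises, the
Jacobian criterion at every point, and one non-degenerate point), and the algebraicity of the
invariant derivations (the Wronskians `Θ_J ∂_xΘ_I - Θ_I ∂_xΘ_J` are quadratic forms in `Θ`, a
strong form of Roy's Lemma 3.1), recorded as fields but not used in this file. The theta model of
`M_κ` is an instance (sequel files); so is `𝔾ₐ × 𝔾ₘ^n`.

This file sets up the Zariski topology of `G` pulled back to `V` (Roy §2.1, §2.3), exactly as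
`GaGmZariski.lean` does for the linear group but projectively, through CONES: a polynomial
`P ∈ R = ℂ[X₀, …, X_N]` is evaluated at all the points `c · Θ(w)`, `c ∈ ℂ`, of the cone over `G`.

* `AnalyticGroupModel V N` — the structure; `M.pt w = Θ(w)`; `M.F P w = P(Θ(w))`, entire in `w`.
* `M.vanishing X` (`𝔍(X)`, the ideal of the cone over `X ⊆ V`): an ideal, radical, HOMOGENEOUS
  (`isHomogeneous_vanishing`: `P(cx) = ∑ c^d P_d(x)` vanishes for all `c` iff every `P_d(x)` does),
  membership of a form `↔` vanishing of `F_P` on `X`; `M.relIdeal = 𝔍(V)` is Roy's `𝔊 = 𝔍(G)`,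
  a PRIME ideal (`isPrime_relIdeal`: the cone is the image of the connected manifold `ℂ × V` under
  an analytic map, and analytic functions on a connected set have no zero divisors —
  the identity theorem `AnalyticOnNhd.eqOn_zero_of_preconnected_of_eventuallyEq_zero`).
* `M.zeroSet F ⊆ V` (`Z_G(F)`), the Galois connection with `𝔍`, `M.IsClosedG`, finite unions and
  intersections, `zeroSet_span`; for homogeneous generators `Z` is the plain zero set of the `F_P`.
* Translations (Roy §3, made global by the addition laws): `M.translForm α v Q = Q(A^α(X, Θ(v)))`,
  a form of degree `c·d` for a form `Q` of degree `d`, with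
  `F_{translForm α v Q}(w) = λ^α(w, v)^d · F_Q(w + v)` (`F_translForm`); hence **translates of
  closed sets are closed** (`IsClosedG.vadd`) and `𝔍(a +ᵥ X)` is described by `translForm`.
* `M.IsIrred X` (closed with prime `𝔍(X)`); `G = V` is irreducible (`isIrred_univ`); an
  irreducible set inside a finite union of closed sets lies in one of them.

Everything here is PROVED (no named facts); nothing is specific to theta functions.

## References

* Yu. V. Nesterenko, P. Philippon (eds.), *Introduction to Algebraic Independence Theory*,
  LNM 1752, Springer 2001, Ch. 11 (D. Roy), §2.1 (addition laws, (84)), §2.3, §3.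
  [NesterenkoPhilippon2001]
* P. Philippon, *Lemmes de zéros dans les groupes algébriques commutatifs*, Bull. Soc. Math.
  France 114 (1986), 355–383, §4.1. [Philippon1986]
-/

noncomputable section

open MvPolynomial Set Filter Topology
open scoped Pointwise

namespace Literature.NumberTheory.Transcendental

/-- **An analytic group model** of a connected commutative algebraic group `G ⊆ ℙ^N(ℂ)` of
dimension `dim`: its Lie algebra `V`, the exponential map in projective coordinates
`Θ_J : V → ℂ` (entire, no common zero), a complete system of addition laws
`A^α_I(Θ(u), Θ(v)) = λ^α(u,v) Θ_I(u+v)` of degree `lawDeg` in the first variables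
(Roy, LNM 1752 Ch. 11 §2.1 (84)), and the algebraic completeness of the embedding: boundary forms
`bdry` with no common zero on `G` such that every point of the projective closure off the
boundary is a `Θ(w)` (`surj`), `N - dim` relations with independent differentials at every point
(`locRel`, the Jacobian criterion), one point where `dim` coordinate ratios have injective
differential (`nondeg`), and the algebraicity of the invariant derivations in the strong form
"`Θ_J ∂_xΘ_I - Θ_I ∂_xΘ_J` is a quadratic form in `Θ`" (`wronsk`; Roy Lemma 3.1 asserts only that
derivatives of regular functions are regular — for the theta model and for `𝔾ₐ × 𝔾ₘⁿ` the chart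
rings are stable under the derivations, which is what we record).
[cite: NesterenkoPhilippon2001, Ch. 11 §2.1 (84), §3 Lemma 3.1] -/
structure AnalyticGroupModel (V : Type*) [NormedAddCommGroup V] [NormedSpace ℂ V] (N : ℕ) where
  /-- The projective coordinates of the exponential map. -/
  Θ : Fin (N + 1) → V → ℂ
  /-- Each coordinate is entire. -/
  analyticOnNhd_Θ : ∀ J, AnalyticOnNhd ℂ (Θ J) univ
  /-- The coordinates have no common zero. -/
  exists_Θ_ne_zero : ∀ w, ∃ J, Θ J w ≠ 0
  /-- Number of addition laws. -/
  nLaw : ℕ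
  /-- Degree of the addition laws in the first set of variables (`c` of Roy §2.1). -/
  lawDeg : ℕ
  /-- `c ≥ 1`. -/
  lawDeg_pos : 0 < lawDeg
  /-- The addition laws `A^α_I(X, v) ∈ ℂ[X]`, for each second argument `v ∈ V`. -/
  law : Fin nLaw → Fin (N + 1) → V → MvPolynomial (Fin (N + 1)) ℂ
  /-- `A^α_I(X, v)` is a form of degree `c`. -/
  isHomogeneous_law : ∀ α I v, (law α I v).IsHomogeneous lawDeg
  /-- The coefficients of `A^α_I(X, v)` are entire functions of `v`. -/
  differentiable_coeff_law : ∀ α I (m : Fin (N + 1) →₀ ℕ), Differentiable ℂ fun v => coeff m (law α I v)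
  /-- The scalar factor `λ^α(u, v)`. -/
  lam : Fin nLaw → V → V → ℂ
  /-- `λ^α` is entire on `V × V`. -/
  analyticOnNhd_lam : ∀ α, AnalyticOnNhd ℂ (Function.uncurry (lam α)) univ
  /-- `A^α_I(Θ(u), v) = λ^α(u,v) Θ_I(u + v)`. -/
  eval_law : ∀ α I u v, eval (fun J => Θ J u) (law α I v) = lam α u v * Θ I (u + v)
  /-- Completeness of the system of addition laws. -/
  exists_lam_ne_zero : ∀ u v, ∃ α, lam α u v ≠ 0
  /-- Boundary forms (`G = Ḡ ∖ Z(bdry)`). -/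
  bdry : Finset (MvPolynomial (Fin (N + 1)) ℂ)
  /-- The boundary forms are homogeneous of positive degree. -/
  isHomogeneous_bdry : ∀ u ∈ bdry, ∃ d, 0 < d ∧ u.IsHomogeneous d
  /-- No point of `G` is on the boundary. -/
  exists_bdry_ne_zero : ∀ w, ∃ u ∈ bdry, eval (fun J => Θ J w) u ≠ 0
  /-- Every point of `Ḡ` off the boundary is on the cone over `Θ(V)`. -/
  surj : ∀ x : Fin (N + 1) → ℂ,
    (∀ (P : MvPolynomial (Fin (N + 1)) ℂ) (d : ℕ), P.IsHomogeneous d →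
      (∀ w, eval (fun J => Θ J w) P = 0) → eval x P = 0) →
    (∃ u ∈ bdry, eval x u ≠ 0) → ∃ (c : ℂ) (w : V), x = c • fun J => Θ J w
  /-- The dimension `n` of `G`. -/
  dim : ℕ
  /-- `dim_ℂ V = n`. -/
  finrank_eq : Module.finrank ℂ V = dim
  /-- Jacobian criterion: at every point, `N - n` homogeneous relations with linearly
  independent differentials. -/
  locRel : ∀ w : V, ∃ S : Finset (MvPolynomial (Fin (N + 1)) ℂ),
    (∀ P ∈ S, ∃ d, P.IsHomogeneous d) ∧ (∀ P ∈ S, ∀ w', eval (fun J => Θ J w') P = 0) ∧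
    S.card + dim = N ∧
    LinearIndependent ℂ fun P : S => fun J => eval (fun J' => Θ J' w) (pderiv J (P : MvPolynomial _ ℂ))
  /-- One point where `n` coordinate ratios have injective differential. -/
  nondeg : ∃ (w₀ : V) (J₀ : Fin (N + 1)) (Js : Fin dim → Fin (N + 1)), Θ J₀ w₀ ≠ 0 ∧
    ∀ x : V, (∀ i, deriv (fun t : ℂ => Θ (Js i) (w₀ + t • x) / Θ J₀ (w₀ + t • x)) 0 = 0) → x = 0
  /-- The Wronskian forms `Q_{x,I,J}` of the invariant derivations (`x ∈ V = Lie G`). -/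
  wronsk : V → Fin (N + 1) → Fin (N + 1) → MvPolynomial (Fin (N + 1)) ℂ
  /-- The Wronskian forms are quadratic. -/
  isHomogeneous_wronsk : ∀ x I J, (wronsk x I J).IsHomogeneous 2
  /-- `Θ_J ∂_xΘ_I - Θ_I ∂_xΘ_J = Q_{x,I,J}(Θ)`: the invariant derivation `∂_x` acts on the
  coordinate ratios `Θ_I/Θ_J` by quadratic forms (so derivatives of regular functions are regular,
  Roy Lemma 3.1, with `c = 2`). -/
  F_wronsk : ∀ x I J w, Θ J w * deriv (fun t : ℂ => Θ I (w + t • x)) 0 -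
    Θ I w * deriv (fun t : ℂ => Θ J (w + t • x)) 0 = eval (fun K => Θ K w) (wronsk x I J)

namespace AnalyticGroupModel

variable {V : Type*} [NormedAddCommGroup V] [NormedSpace ℂ V] {N : ℕ} (M : AnalyticGroupModel V N)

/-! ### Points of the cone and evaluation -/

/-- The point `Θ(w) ∈ ℂ^{N+1}` over `w ∈ V`. [cite: NesterenkoPhilippon2001, Ch. 11 §2.3 (G̃)] -/
def pt (w : V) : Fin (N + 1) → ℂ := fun J => M.Θ J w

/-- `Θ(w)_J = Θ_J(w)`. [folklore] -/
@[simp] theorem pt_apply (w : V) (J : Fin (N + 1)) : M.pt w J = M.Θ J w := rfl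

/-- `Θ(w) ≠ 0`. [folklore] -/
theorem pt_ne_zero (w : V) : M.pt w ≠ 0 := by
  obtain ⟨J, hJ⟩ := M.exists_Θ_ne_zero w
  exact fun h => hJ (by simpa using congr_fun h J)

/-- **`F_P(w) = P(Θ(w))`**, the entire function attached to a polynomial.
[cite: NesterenkoPhilippon2001, Ch. 11 §2.3] -/
def F (P : MvPolynomial (Fin (N + 1)) ℂ) (w : V) : ℂ := eval (M.pt w) P

/-- Unfolding `F`. [folklore] -/
theorem F_apply (P : MvPolynomial (Fin (N + 1)) ℂ) (w : V) : M.F P w = eval (M.pt w) P := rfl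

/-- `F_{X_J} = Θ_J`. [folklore] -/
@[simp] theorem F_X (J : Fin (N + 1)) (w : V) : M.F (X J) w = M.Θ J w := by simp [F]

/-- `F_{C a} = a`. [folklore] -/
@[simp] theorem F_C (a : ℂ) (w : V) : M.F (C a) w = a := by simp [F]

/-- `F_{P+Q} = F_P + F_Q`. [folklore] -/
@[simp] theorem F_add (P Q : MvPolynomial (Fin (N + 1)) ℂ) (w : V) :
    M.F (P + Q) w = M.F P w + M.F Q w := by simp [F]

/-- `F_{PQ} = F_P F_Q`. [folklore] -/
@[simp] theorem F_mul (P Q : MvPolynomial (Fin (N + 1)) ℂ) (w : V) :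
    M.F (P * Q) w = M.F P w * M.F Q w := by simp [F]

/-- `F_{P^k} = F_P^k`. [folklore] -/
@[simp] theorem F_pow (P : MvPolynomial (Fin (N + 1)) ℂ) (k : ℕ) (w : V) :
    M.F (P ^ k) w = M.F P w ^ k := by simp [F]

/-- Values on the cone: `P(c Θ(w)) = c^d F_P(w)` for a form of degree `d`. [folklore] -/
theorem eval_smul_pt {P : MvPolynomial (Fin (N + 1)) ℂ} {d : ℕ} (hP : P.IsHomogeneous d)
    (c : ℂ) (w : V) : eval (c • M.pt w) P = c ^ d * M.F P w :=
  Literature.RingTheory.MvPolynomial.eval_smul_of_isHomogeneous hP c _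

/-- `F_P` is entire. [folklore] -/
theorem analyticOnNhd_F (P : MvPolynomial (Fin (N + 1)) ℂ) : AnalyticOnNhd ℂ (M.F P) univ := by
  have h := AnalyticOnNhd.aeval_mvPolynomial (𝕜 := ℂ) (A := ℂ) (B := ℂ)
    (f := fun (w : V) (J : Fin (N + 1)) => M.Θ J w) (s := univ) (fun J => M.analyticOnNhd_Θ J) P
  have hfun : (fun w : V => aeval (fun J : Fin (N + 1) => M.Θ J w) P) = M.F P := by
    funext w
    rw [F, ← coe_aeval_eq_eval]
    rfl
  rwa [hfun] at h

/-- `F_P` is continuous. [folklore] -/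
theorem continuous_F (P : MvPolynomial (Fin (N + 1)) ℂ) : Continuous (M.F P) :=
  (M.analyticOnNhd_F P).continuous

/-- The cone map `(c, w) ↦ P(c Θ(w))` is entire on `ℂ × V`. [folklore] -/
theorem analyticOnNhd_eval_cone (P : MvPolynomial (Fin (N + 1)) ℂ) :
    AnalyticOnNhd ℂ (fun p : ℂ × V => eval (p.1 • M.pt p.2) P) univ := by
  have hΘ : ∀ J, AnalyticOnNhd ℂ (fun p : ℂ × V => p.1 * M.Θ J p.2) univ := fun J =>
    analyticOnNhd_fst.mul ((M.analyticOnNhd_Θ J).comp analyticOnNhd_snd (mapsTo_univ _ _))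
  have h := AnalyticOnNhd.aeval_mvPolynomial (𝕜 := ℂ) (A := ℂ) (B := ℂ)
    (f := fun (p : ℂ × V) (J : Fin (N + 1)) => p.1 * M.Θ J p.2) (s := univ) hΘ P
  have hfun : (fun p : ℂ × V => aeval (fun J : Fin (N + 1) => p.1 * M.Θ J p.2) P) =
      fun p : ℂ × V => eval (p.1 • M.pt p.2) P := by
    funext p
    rw [← coe_aeval_eq_eval]
    rfl
  rwa [hfun] at h

/-- The polynomial function `t ↦ P(t x)` on a line through the origin is entire. [folklore] -/
theorem analyticOnNhd_eval_line (P : MvPolynomial (Fin (N + 1)) ℂ) (x : Fin (N + 1) → ℂ) :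
    AnalyticOnNhd ℂ (fun t : ℂ => eval (t • x) P) univ := by
  have hΘ : ∀ J, AnalyticOnNhd ℂ (fun t : ℂ => t * x J) univ := fun J =>
    analyticOnNhd_id.mul analyticOnNhd_const
  have h := AnalyticOnNhd.aeval_mvPolynomial (𝕜 := ℂ) (A := ℂ) (B := ℂ)
    (f := fun (t : ℂ) (J : Fin (N + 1)) => t * x J) (s := univ) hΘ P
  have hfun : (fun t : ℂ => aeval (fun J : Fin (N + 1) => t * x J) P) = fun t : ℂ => eval (t • x) P := by
    funext t
    rw [← coe_aeval_eq_eval]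
    rfl
  rwa [hfun] at h

/-- **Analytic functions on a normed space have no zero divisors**: if the product of two entire
functions vanishes identically, one of them does (identity theorem). [folklore] -/
theorem eq_zero_or_eq_zero_of_mul_eq_zero {E : Type*} [NormedAddCommGroup E] [NormedSpace ℂ E]
    {f g : E → ℂ} (hf : AnalyticOnNhd ℂ f univ) (hg : AnalyticOnNhd ℂ g univ)
    (h : ∀ z, f z * g z = 0) : (∀ z, f z = 0) ∨ ∀ z, g z = 0 := by
  by_cases hf0 : ∀ z, f z = 0
  · exact Or.inl hf0
  push Not at hf0
  obtain ⟨z₀, hz₀⟩ := hf0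
  right
  have hev : ∀ᶠ z in 𝓝 z₀, f z ≠ 0 := (hf z₀ trivial).continuousAt.eventually_ne hz₀
  have hg0 : g =ᶠ[𝓝 z₀] 0 := hev.mono fun z hz => (mul_eq_zero.mp (h z)).resolve_left hz
  have := hg.eqOn_zero_of_preconnected_of_eventuallyEq_zero isPreconnected_univ (mem_univ z₀) hg0
  exact fun z => this (mem_univ z)

/-! ### The ideal of the cone over a subset (Roy §2.3) -/

/-- **`𝔍(X)`, the ideal of the cone over `X ⊆ V`**: the polynomials vanishing at every
`c · Θ(w)`, `w ∈ X`, `c ∈ ℂ` (for `X = V` this is `𝔊 = 𝔍(G)`).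
[cite: NesterenkoPhilippon2001, Ch. 11 §2.2 (𝔍(E)), §2.3] -/
def vanishing (X : Set V) : Ideal (MvPolynomial (Fin (N + 1)) ℂ) where
  carrier := {P | ∀ w ∈ X, ∀ c : ℂ, eval (c • M.pt w) P = 0}
  zero_mem' := by simp
  add_mem' := by
    intro P Q hP hQ w hw c
    simp [hP w hw c, hQ w hw c]
  smul_mem' := by
    intro P Q hQ w hw c
    simp [hQ w hw c]

/-- Membership in `𝔍(X)`. [folklore] -/
theorem mem_vanishing_iff {X : Set V} {P : MvPolynomial (Fin (N + 1)) ℂ} :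
    P ∈ M.vanishing X ↔ ∀ w ∈ X, ∀ c : ℂ, eval (c • M.pt w) P = 0 := Iff.rfl

/-- `𝔍` is antitone. [folklore] -/
theorem vanishing_antitone {X Y : Set V} (h : X ⊆ Y) : M.vanishing Y ≤ M.vanishing X :=
  fun _ hP w hw c => hP w (h hw) c

/-- `𝔍(∅) = (1)`. [folklore] -/
@[simp] theorem vanishing_empty : M.vanishing (∅ : Set V) = ⊤ :=
  eq_top_iff.mpr fun _ _ w hw => absurd hw (notMem_empty w)

/-- A polynomial vanishing on the line `ℂ·x` has all its homogeneous components vanishing at `x`.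
[folklore] -/
theorem eval_homogeneousComponent_eq_zero {P : MvPolynomial (Fin (N + 1)) ℂ}
    {x : Fin (N + 1) → ℂ} (h : ∀ c : ℂ, eval (c • x) P = 0) (d : ℕ) :
    eval x (homogeneousComponent d P) = 0 := by
  classical
  -- the one-variable polynomial `c ↦ P(cx) = ∑_d c^d P_d(x)`
  set q : Polynomial ℂ := ∑ i ∈ Finset.range (P.totalDegree + 1),
    Polynomial.monomial i (eval x (homogeneousComponent i P)) with hq
  have hqeval : ∀ c : ℂ, q.eval c = eval (c • x) P := by
    intro c
    conv_rhs => rw [← sum_homogeneousComponent P]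
    rw [hq, Polynomial.eval_finsetSum, map_sum]
    refine Finset.sum_congr rfl fun i _ => ?_
    rw [Polynomial.eval_monomial, Literature.RingTheory.MvPolynomial.eval_smul_of_isHomogeneous
      (homogeneousComponent_isHomogeneous i P)]
    ring
  have hq0 : q = 0 := by
    apply Polynomial.funext
    intro c
    rw [hqeval, h c, Polynomial.eval_zero]
  have hcoeff : q.coeff d = 0 := by rw [hq0, Polynomial.coeff_zero]
  rw [hq, Polynomial.finsetSum_coeff] at hcoeff
  simp only [Polynomial.coeff_monomial, Finset.sum_ite_eq', Finset.mem_range] at hcoeff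
  by_cases hd : d < P.totalDegree + 1
  · rwa [if_pos hd] at hcoeff
  · rw [homogeneousComponent_eq_zero _ _ (by omega), map_zero]

attribute [local instance] MvPolynomial.gradedAlgebra

/-- **`𝔍(X)` is a homogeneous ideal.** [cite: NesterenkoPhilippon2001, Ch. 11 §2.2] -/
theorem isHomogeneous_vanishing (X : Set V) :
    (M.vanishing X).IsHomogeneous (homogeneousSubmodule (Fin (N + 1)) ℂ) := by
  intro d P hP
  rw [← DirectSum.Decomposition.decompose'_eq, decomposition.decompose'_apply]
  intro w hw c
  rw [Literature.RingTheory.MvPolynomial.eval_smul_of_isHomogeneous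
    (homogeneousComponent_isHomogeneous d P), eval_homogeneousComponent_eq_zero (hP w hw) d,
    mul_zero]

/-- Homogeneous components of members of `𝔍(X)` are in `𝔍(X)`. [folklore] -/
theorem homogeneousComponent_mem_vanishing {X : Set V} {P : MvPolynomial (Fin (N + 1)) ℂ}
    (hP : P ∈ M.vanishing X) (d : ℕ) : homogeneousComponent d P ∈ M.vanishing X :=
  homogeneousComponent_mem_of_mem (M.isHomogeneous_vanishing X) hP d

/-- **A form lies in `𝔍(X)` iff `F_P` vanishes on `X`.** [folklore] -/
theorem mem_vanishing_iff_of_isHomogeneous {X : Set V} {P : MvPolynomial (Fin (N + 1)) ℂ} {d : ℕ}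
    (hP : P.IsHomogeneous d) : P ∈ M.vanishing X ↔ ∀ w ∈ X, M.F P w = 0 := by
  constructor
  · intro h w hw
    simpa [F, one_smul] using h w hw 1
  · intro h w hw c
    rw [M.eval_smul_pt hP, h w hw, mul_zero]

/-- A polynomial is in `𝔍(X)` iff all its homogeneous components vanish (as functions `F`) on `X`.
[folklore] -/
theorem mem_vanishing_iff_forall_homogeneousComponent {X : Set V} {P : MvPolynomial (Fin (N + 1)) ℂ} :
    P ∈ M.vanishing X ↔ ∀ d, ∀ w ∈ X, M.F (homogeneousComponent d P) w = 0 := by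
  constructor
  · intro h d
    exact (M.mem_vanishing_iff_of_isHomogeneous (homogeneousComponent_isHomogeneous d P)).mp
      (M.homogeneousComponent_mem_vanishing h d)
  · intro h
    rw [← sum_homogeneousComponent P]
    refine Ideal.sum_mem _ fun d _ => ?_
    exact (M.mem_vanishing_iff_of_isHomogeneous (homogeneousComponent_isHomogeneous d P)).mpr (h d)

/-- `𝔍(X)` is a radical ideal. [folklore] -/
theorem isRadical_vanishing (X : Set V) : (M.vanishing X).IsRadical := by
  rintro P ⟨k, hk⟩ w hw c
  have := hk w hw c
  rw [map_pow] at this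
  exact (pow_eq_zero_iff'.mp this).1

/-! ### The ideal `𝔊` of `G` -/

/-- **`𝔊 = 𝔍(G)`**, the ideal of the cone over the whole group. [cite: NesterenkoPhilippon2001, Ch. 11 Def. 2.1 (𝔊)] -/
def relIdeal : Ideal (MvPolynomial (Fin (N + 1)) ℂ) := M.vanishing univ

/-- Membership of a form in `𝔊`: `F_P ≡ 0`. [folklore] -/
theorem mem_relIdeal_iff_of_isHomogeneous {P : MvPolynomial (Fin (N + 1)) ℂ} {d : ℕ}
    (hP : P.IsHomogeneous d) : P ∈ M.relIdeal ↔ ∀ w, M.F P w = 0 := by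
  rw [relIdeal, M.mem_vanishing_iff_of_isHomogeneous hP]
  simp

/-- `𝔊 ⊆ 𝔍(X)` for every `X`. [folklore] -/
theorem relIdeal_le_vanishing (X : Set V) : M.relIdeal ≤ M.vanishing X :=
  M.vanishing_antitone (subset_univ X)

/-- `𝔊` is homogeneous. [folklore] -/
theorem isHomogeneous_relIdeal : M.relIdeal.IsHomogeneous (homogeneousSubmodule (Fin (N + 1)) ℂ) :=
  M.isHomogeneous_vanishing univ

/-- `1 ∉ 𝔊`. [folklore] -/
theorem relIdeal_ne_top : M.relIdeal ≠ ⊤ := by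
  intro h
  have h1 : (1 : MvPolynomial (Fin (N + 1)) ℂ) ∈ M.relIdeal := h ▸ Submodule.mem_top
  obtain ⟨w⟩ : Nonempty V := ⟨0⟩
  have := h1 w (mem_univ w) 1
  simp at this

/-- **`𝔊` is prime**: the cone over `G` is the analytic image of the connected space `ℂ × V`,
on which analytic functions have no zero divisors. [cite: NesterenkoPhilippon2001, Ch. 11 §2.1 (G irreducible)] -/
theorem isPrime_relIdeal : M.relIdeal.IsPrime := by
  refine ⟨M.relIdeal_ne_top, fun {P Q} hPQ => ?_⟩
  have h := eq_zero_or_eq_zero_of_mul_eq_zero (M.analyticOnNhd_eval_cone P)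
    (M.analyticOnNhd_eval_cone Q) fun p => by
      have := hPQ p.2 (mem_univ _) p.1
      rwa [map_mul] at this
  rcases h with h | h
  · exact Or.inl fun w _ c => h (c, w)
  · exact Or.inr fun w _ c => h (c, w)

/-! ### Zero sets and closed sets (Roy §2.1) -/

/-- **`Z_G(F) ⊆ V`**: the points `w` such that every member of `F` vanishes on the line
`ℂ · Θ(w)` (for a set of forms: the common zeros of the `F_P` on `G`, pulled back to `V`).
[cite: NesterenkoPhilippon2001, Ch. 11 §2.1 (Z(I))] -/
def zeroSet (F : Set (MvPolynomial (Fin (N + 1)) ℂ)) : Set V :=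
  {w | ∀ P ∈ F, ∀ c : ℂ, eval (c • M.pt w) P = 0}

/-- Membership in `Z_G(F)`. [folklore] -/
theorem mem_zeroSet_iff {F : Set (MvPolynomial (Fin (N + 1)) ℂ)} {w : V} :
    w ∈ M.zeroSet F ↔ ∀ P ∈ F, ∀ c : ℂ, eval (c • M.pt w) P = 0 := Iff.rfl

/-- For a set of FORMS, `Z_G(F)` is the set of common zeros of the `F_P`. [folklore] -/
theorem mem_zeroSet_iff_of_isHomogeneous {S : Set (MvPolynomial (Fin (N + 1)) ℂ)}
    (hS : ∀ P ∈ S, ∃ d, P.IsHomogeneous d) {w : V} :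
    w ∈ M.zeroSet S ↔ ∀ P ∈ S, M.F P w = 0 := by
  constructor
  · intro h P hP
    simpa [F, one_smul] using h P hP 1
  · intro h P hP c
    obtain ⟨d, hd⟩ := hS P hP
    rw [M.eval_smul_pt hd, h P hP, mul_zero]

/-- `Z_G` is antitone. [folklore] -/
theorem zeroSet_antitone {F F' : Set (MvPolynomial (Fin (N + 1)) ℂ)} (h : F ⊆ F') :
    M.zeroSet F' ⊆ M.zeroSet F := fun _ hw P hP c => hw P (h hP) c

/-- `X ⊆ Z_G(𝔍(X))`. [folklore] -/
theorem subset_zeroSet_vanishing (X : Set V) : X ⊆ M.zeroSet (M.vanishing X) :=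
  fun _ hw _ hP c => hP _ hw c

/-- `F ⊆ 𝔍(Z_G(F))`. [folklore] -/
theorem subset_vanishing_zeroSet (F : Set (MvPolynomial (Fin (N + 1)) ℂ)) :
    F ⊆ M.vanishing (M.zeroSet F) := fun _ hP _ hw c => hw _ hP c

/-- `Z_G(span F) = Z_G(F)`. [folklore] -/
theorem zeroSet_span (F : Set (MvPolynomial (Fin (N + 1)) ℂ)) :
    M.zeroSet (Ideal.span F : Set (MvPolynomial (Fin (N + 1)) ℂ)) = M.zeroSet F := by
  refine Subset.antisymm (M.zeroSet_antitone Ideal.subset_span) fun w hw P hP c => ?_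
  have : Ideal.span F ≤ RingHom.ker (eval (c • M.pt w)) :=
    Ideal.span_le.mpr fun Q hQ => by simpa [RingHom.mem_ker] using hw Q hQ c
  simpa [RingHom.mem_ker] using this hP

/-- `Z_G(𝔍(Z_G(F))) = Z_G(F)`. [folklore] -/
theorem zeroSet_vanishing_zeroSet (F : Set (MvPolynomial (Fin (N + 1)) ℂ)) :
    M.zeroSet (M.vanishing (M.zeroSet F)) = M.zeroSet F :=
  Subset.antisymm (M.zeroSet_antitone (M.subset_vanishing_zeroSet F))
    (M.subset_zeroSet_vanishing _)

/-- `𝔍(Z_G(𝔍(X))) = 𝔍(X)`. [folklore] -/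
theorem vanishing_zeroSet_vanishing (X : Set V) :
    M.vanishing (M.zeroSet (M.vanishing X)) = M.vanishing X :=
  le_antisymm (M.vanishing_antitone (M.subset_zeroSet_vanishing X))
    (M.subset_vanishing_zeroSet _)

/-- `Z_G(1) = ∅`, `Z_G(⊤) = ∅`. [folklore] -/
@[simp] theorem zeroSet_top : M.zeroSet ((⊤ : Ideal (MvPolynomial (Fin (N + 1)) ℂ)) : Set _) = ∅ := by
  ext w
  simp only [mem_zeroSet_iff, SetLike.mem_coe, Submodule.mem_top, forall_const, mem_empty_iff_false,
    iff_false, not_forall]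
  exact ⟨1, 1, by simp⟩

/-- `Z_G(𝔊) = V`. [folklore] -/
@[simp] theorem zeroSet_relIdeal : M.zeroSet (M.relIdeal : Set (MvPolynomial (Fin (N + 1)) ℂ)) = univ :=
  eq_univ_of_forall fun w _ hP c => hP w (mem_univ w) c

/-- **Closed subsets of `G`** (pulled back to `V`): `X = Z_G(𝔍(X))`.
[cite: NesterenkoPhilippon2001, Ch. 11 §2.1] -/
def IsClosedG (X : Set V) : Prop := M.zeroSet (M.vanishing X) = X

/-- Zero sets are closed. [folklore] -/
theorem isClosedG_zeroSet (F : Set (MvPolynomial (Fin (N + 1)) ℂ)) : M.IsClosedG (M.zeroSet F) :=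
  M.zeroSet_vanishing_zeroSet F

/-- The defining equation of a closed set. [folklore] -/
theorem IsClosedG.eq {X : Set V} (h : M.IsClosedG X) : M.zeroSet (M.vanishing X) = X := h

/-- `V` is closed. [folklore] -/
theorem isClosedG_univ : M.IsClosedG (univ : Set V) :=
  eq_univ_of_forall fun w => M.subset_zeroSet_vanishing univ (mem_univ w)

/-- `∅` is closed. [folklore] -/
theorem isClosedG_empty : M.IsClosedG (∅ : Set V) := by
  rw [IsClosedG, vanishing_empty, zeroSet_top]

/-- `Z_G(I ∩ J) = Z_G(I) ∪ Z_G(J)` for ideals (the line `ℂ·Θ(w)` is irreducible). [folklore] -/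
theorem zeroSet_inf (I J : Ideal (MvPolynomial (Fin (N + 1)) ℂ)) :
    M.zeroSet ((I ⊓ J : Ideal _) : Set (MvPolynomial (Fin (N + 1)) ℂ)) = M.zeroSet I ∪ M.zeroSet J := by
  ext w
  constructor
  · intro hw
    by_cases hI : w ∈ M.zeroSet (I : Set (MvPolynomial (Fin (N + 1)) ℂ))
    · exact Or.inl hI
    · right
      intro Q hQ c'
      obtain ⟨P, hP, c, hPc⟩ : ∃ P ∈ I, ∃ c : ℂ, eval (c • M.pt w) P ≠ 0 := by
        by_contra hcon
        push Not at hcon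
        exact hI fun P hP c => hcon P hP c
      have hPQ : P * Q ∈ I ⊓ J := ⟨I.mul_mem_right Q hP, J.mul_mem_left P hQ⟩
      have hline : ∀ t : ℂ, eval (t • M.pt w) P * eval (t • M.pt w) Q = 0 := fun t => by
        have := hw (P * Q) hPQ t
        rwa [map_mul] at this
      rcases eq_zero_or_eq_zero_of_mul_eq_zero (analyticOnNhd_eval_line P _)
        (analyticOnNhd_eval_line Q _) hline with h | h
      · exact absurd (h c) hPc
      · exact h c'
  · rintro (hw | hw)
    · exact fun P hP c => hw P hP.1 c
    · exact fun P hP c => hw P hP.2 c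

/-- A finite union of closed sets is closed. [folklore] -/
theorem IsClosedG.union {X Y : Set V} (hX : M.IsClosedG X) (hY : M.IsClosedG Y) :
    M.IsClosedG (X ∪ Y) := by
  have : X ∪ Y = M.zeroSet ((M.vanishing X ⊓ M.vanishing Y : Ideal _) : Set _) := by
    rw [zeroSet_inf, hX.eq, hY.eq]
  rw [this]
  exact M.isClosedG_zeroSet _

/-- An intersection of closed sets is closed. [folklore] -/
theorem IsClosedG.iInter {ι : Sort*} {X : ι → Set V} (hX : ∀ i, M.IsClosedG (X i)) :
    M.IsClosedG (⋂ i, X i) := by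
  have : (⋂ i, X i) = M.zeroSet (⋃ i, (M.vanishing (X i) : Set (MvPolynomial (Fin (N + 1)) ℂ))) := by
    ext w
    simp only [mem_iInter, mem_zeroSet_iff, mem_iUnion, SetLike.mem_coe, forall_exists_index]
    constructor
    · intro hw P i hP c
      exact hP w (hw i) c
    · intro hw i
      rw [← (hX i).eq]
      exact fun P hP c => hw P i hP c
  rw [this]
  exact M.isClosedG_zeroSet _

/-- The intersection of two closed sets is closed. [folklore] -/
theorem IsClosedG.inter {X Y : Set V} (hX : M.IsClosedG X) (hY : M.IsClosedG Y) :
    M.IsClosedG (X ∩ Y) := by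
  rw [inter_eq_iInter]
  exact IsClosedG.iInter M fun b => by cases b <;> assumption

/-- A closed set is determined by its ideal. [folklore] -/
theorem IsClosedG.eq_of_vanishing_eq {X Y : Set V} (hX : M.IsClosedG X) (hY : M.IsClosedG Y)
    (h : M.vanishing X = M.vanishing Y) : X = Y := by
  rw [← hX.eq, ← hY.eq, h]

/-- Closed sets with `𝔍(Y) ≤ 𝔍(X)` satisfy `X ⊆ Y`. [folklore] -/
theorem IsClosedG.subset_of_vanishing_le {X Y : Set V} (hY : M.IsClosedG Y)
    (h : M.vanishing Y ≤ M.vanishing X) : X ⊆ Y := by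
  rw [← hY.eq]
  exact (M.subset_zeroSet_vanishing X).trans (M.zeroSet_antitone h)

/-! ### Translations via the addition laws (Roy §3) -/

/-- Evaluation of a substitution: `(bind₁ g Q)(x) = Q((g i)(x))`. [folklore] -/
theorem eval_bind₁ {σ τ : Type*} (x : τ → ℂ) (g : σ → MvPolynomial τ ℂ) (Q : MvPolynomial σ ℂ) :
    eval x (bind₁ g Q) = eval (fun i => eval x (g i)) Q :=
  eval₂Hom_bind₁ _ _ _ _

/-- **The specialised addition law `A^α_I(X, Θ(v)) ∈ ℂ[X]`.** [cite: NesterenkoPhilippon2001, Ch. 11 Prop. 3.6 (iv)] -/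
def lawAt (α : Fin M.nLaw) (I : Fin (N + 1)) (v : V) : MvPolynomial (Fin (N + 1)) ℂ :=
  M.law α I v

/-- **The translated form `Q(A^α(X, Θ(v)))`**: substitute the addition law with second argument
specialised at `Θ(v)`. [cite: NesterenkoPhilippon2001, Ch. 11 Prop. 3.6 (iv)] -/
def translForm (α : Fin M.nLaw) (v : V) (Q : MvPolynomial (Fin (N + 1)) ℂ) :
    MvPolynomial (Fin (N + 1)) ℂ :=
  bind₁ (fun I => M.lawAt α I v) Q

/-- The specialised law `A^α_I(X, Θ(v))` is a form of degree `c`. [folklore] -/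
theorem isHomogeneous_lawAt (α : Fin M.nLaw) (I : Fin (N + 1)) (v : V) :
    (M.lawAt α I v).IsHomogeneous M.lawDeg :=
  M.isHomogeneous_law α I v

/-- `translForm` of a form of degree `d` is a form of degree `c·d`. [folklore] -/
theorem isHomogeneous_translForm (α : Fin M.nLaw) (v : V) {Q : MvPolynomial (Fin (N + 1)) ℂ}
    {d : ℕ} (hQ : Q.IsHomogeneous d) : (M.translForm α v Q).IsHomogeneous (M.lawDeg * d) := by
  rw [translForm, ← aeval_eq_bind₁]
  exact hQ.aeval _ fun I => M.isHomogeneous_lawAt α I v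

/-- Evaluation of the specialised law: `A^α_I(Θ(w), Θ(v)) = λ^α(w,v) Θ_I(w+v)`. [folklore] -/
theorem F_lawAt (α : Fin M.nLaw) (I : Fin (N + 1)) (v w : V) :
    M.F (M.lawAt α I v) w = M.lam α w v * M.Θ I (w + v) :=
  M.eval_law α I w v

/-- **`F_{Q(A^α(X,Θ(v)))}(w) = λ^α(w, v)^d F_Q(w + v)`** for a form `Q` of degree `d`.
[cite: NesterenkoPhilippon2001, Ch. 11 Prop. 3.6 (iv) (proof)] -/
theorem F_translForm (α : Fin M.nLaw) (v : V) {Q : MvPolynomial (Fin (N + 1)) ℂ} {d : ℕ}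
    (hQ : Q.IsHomogeneous d) (w : V) :
    M.F (M.translForm α v Q) w = M.lam α w v ^ d * M.F Q (w + v) := by
  have h1 : M.F (M.translForm α v Q) w = eval (fun I => M.lam α w v * M.Θ I (w + v)) Q := by
    rw [F, translForm, AnalyticGroupModel.eval_bind₁]
    congr 2
    funext I
    exact M.F_lawAt α I v w
  rw [h1, show (fun I => M.lam α w v * M.Θ I (w + v)) = M.lam α w v • M.pt (w + v) from rfl,
    M.eval_smul_pt hQ]

/-- The set of translated forms of the members of a homogeneous ideal `I`, by `-a`: its zero set
is `a +ᵥ Z_G(I)`. [folklore] -/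
def translSet (a : V) (I : Ideal (MvPolynomial (Fin (N + 1)) ℂ)) : Set (MvPolynomial (Fin (N + 1)) ℂ) :=
  {R | ∃ (α : Fin M.nLaw) (Q : MvPolynomial (Fin (N + 1)) ℂ) (d : ℕ),
    Q ∈ I ∧ Q.IsHomogeneous d ∧ R = M.translForm α (-a) Q}

/-- Members of `translSet` are forms. [folklore] -/
theorem isHomogeneous_of_mem_translSet {a : V} {I : Ideal (MvPolynomial (Fin (N + 1)) ℂ)}
    {R : MvPolynomial (Fin (N + 1)) ℂ} (hR : R ∈ M.translSet a I) : ∃ d, R.IsHomogeneous d := by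
  obtain ⟨α, Q, d, -, hQ, rfl⟩ := hR
  exact ⟨_, M.isHomogeneous_translForm α (-a) hQ⟩

/-- **`Z_G(translSet a I) = a +ᵥ Z_G(I)`** for a homogeneous ideal `I`: translates of closed
sets are cut out by translated forms. [cite: NesterenkoPhilippon2001, Ch. 11 Thm. 4.1 (a)] -/
theorem zeroSet_translSet (a : V) {I : Ideal (MvPolynomial (Fin (N + 1)) ℂ)}
    (hI : I.IsHomogeneous (homogeneousSubmodule (Fin (N + 1)) ℂ)) :
    M.zeroSet (M.translSet a I) = a +ᵥ M.zeroSet (I : Set (MvPolynomial (Fin (N + 1)) ℂ)) := by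
  ext w
  rw [M.mem_zeroSet_iff_of_isHomogeneous fun R hR => M.isHomogeneous_of_mem_translSet hR,
    Set.mem_vadd_set]
  constructor
  · intro hw
    refine ⟨-a + w, ?_, by simp⟩
    intro P hP c
    -- every homogeneous component of `P` lies in `I` and is killed at `w - a`
    rw [← sum_homogeneousComponent P, map_sum]
    refine Finset.sum_eq_zero fun d _ => ?_
    have hPd : homogeneousComponent d P ∈ I := homogeneousComponent_mem_of_mem hI hP d
    obtain ⟨α, hα⟩ := M.exists_lam_ne_zero w (-a)
    have := hw _ ⟨α, _, d, hPd, homogeneousComponent_isHomogeneous d P, rfl⟩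
    rw [M.F_translForm α (-a) (homogeneousComponent_isHomogeneous d P)] at this
    have hF : M.F (homogeneousComponent d P) (w + -a) = 0 :=
      (mul_eq_zero.mp this).resolve_left (pow_ne_zero _ hα)
    rw [M.eval_smul_pt (homogeneousComponent_isHomogeneous d P), show -a + w = w + -a by abel, hF,
      mul_zero]
  · rintro ⟨u, hu, rfl⟩ R ⟨α, Q, d, hQ, hQd, rfl⟩
    rw [M.F_translForm α (-a) hQd, show (a +ᵥ u) + -a = u by simp [vadd_eq_add]]
    have := hu Q hQ 1
    rw [one_smul] at this
    rw [show M.F Q u = eval (M.pt u) Q from rfl, this, mul_zero]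

/-- **Translates of closed sets are closed.** [cite: NesterenkoPhilippon2001, Ch. 11 Thm. 4.1 (a)] -/
theorem IsClosedG.vadd {X : Set V} (hX : M.IsClosedG X) (a : V) : M.IsClosedG (a +ᵥ X) := by
  rw [← hX.eq, ← M.zeroSet_translSet a (M.isHomogeneous_vanishing X)]
  exact M.isClosedG_zeroSet _

/-- `𝔍(a +ᵥ X)` in terms of `𝔍(X)`: a form `R` vanishes on `a + X` iff the forms
`translForm α a R` vanish on `X` for all laws `α`. [folklore] -/
theorem mem_vanishing_vadd_iff {X : Set V} {R : MvPolynomial (Fin (N + 1)) ℂ} {d : ℕ}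
    (hR : R.IsHomogeneous d) (a : V) :
    R ∈ M.vanishing (a +ᵥ X) ↔ ∀ α, M.translForm α a R ∈ M.vanishing X := by
  rw [M.mem_vanishing_iff_of_isHomogeneous hR]
  constructor
  · intro h α
    rw [M.mem_vanishing_iff_of_isHomogeneous (M.isHomogeneous_translForm α a hR)]
    intro w hw
    rw [M.F_translForm α a hR, h (w + a) ⟨w, hw, by simp [add_comm]⟩, mul_zero]
  · intro h w hw
    obtain ⟨u, hu, rfl⟩ := Set.mem_vadd_set.mp hw
    obtain ⟨α, hα⟩ := M.exists_lam_ne_zero u a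
    have := (M.mem_vanishing_iff_of_isHomogeneous (M.isHomogeneous_translForm α a hR)).mp (h α) u hu
    rw [M.F_translForm α a hR] at this
    simpa [add_comm] using (mul_eq_zero.mp this).resolve_left (pow_ne_zero _ hα)

/-! ### Irreducible closed sets -/

/-- **Irreducible closed subsets**: closed with prime ideal. [cite: NesterenkoPhilippon2001, Ch. 11 §2.1] -/
def IsIrred (X : Set V) : Prop := M.IsClosedG X ∧ (M.vanishing X).IsPrime

/-- An irreducible set is closed. [folklore] -/
theorem IsIrred.isClosedG {X : Set V} (h : M.IsIrred X) : M.IsClosedG X := h.1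

/-- An irreducible set has prime ideal. [folklore] -/
theorem IsIrred.isPrime {X : Set V} (h : M.IsIrred X) : (M.vanishing X).IsPrime := h.2

/-- An irreducible set is non-empty. [folklore] -/
theorem IsIrred.nonempty {X : Set V} (h : M.IsIrred X) : X.Nonempty := by
  by_contra hX
  rw [not_nonempty_iff_eq_empty] at hX
  exact h.2.ne_top (by rw [hX, vanishing_empty])

/-- **`G` is irreducible.** [cite: NesterenkoPhilippon2001, Ch. 11 §2.1] -/
theorem isIrred_univ : M.IsIrred (univ : Set V) := ⟨M.isClosedG_univ, M.isPrime_relIdeal⟩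

/-- An irreducible set contained in `Y ∪ Z` (closed) lies in `Y` or in `Z`. [folklore] -/
theorem IsIrred.subset_or_subset {X Y Z : Set V} (hX : M.IsIrred X) (hY : M.IsClosedG Y)
    (hZ : M.IsClosedG Z) (h : X ⊆ Y ∪ Z) : X ⊆ Y ∨ X ⊆ Z := by
  by_contra hcon
  push Not at hcon
  obtain ⟨h1, h2⟩ := hcon
  -- `𝔍(Y) ⊄ 𝔍(X)` and `𝔍(Z) ⊄ 𝔍(X)`
  have hY' : ¬ M.vanishing Y ≤ M.vanishing X := fun hle => h1 (hY.subset_of_vanishing_le M hle |>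
    fun h' => by
      -- from `𝔍(Y) ≤ 𝔍(X)` we get `X ⊆ Z(𝔍 X) ⊆ Z(𝔍 Y) = Y`
      exact (M.subset_zeroSet_vanishing X).trans ((M.zeroSet_antitone hle).trans_eq hY.eq))
  have hZ' : ¬ M.vanishing Z ≤ M.vanishing X := fun hle =>
    h2 ((M.subset_zeroSet_vanishing X).trans ((M.zeroSet_antitone hle).trans_eq hZ.eq))
  obtain ⟨P, hPY, hPX⟩ := Set.not_subset.mp hY'
  obtain ⟨Q, hQZ, hQX⟩ := Set.not_subset.mp hZ'
  have hPQ : P * Q ∈ M.vanishing X := by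
    intro w hw c
    rcases h hw with hw' | hw'
    · rw [map_mul, hPY w hw' c, zero_mul]
    · rw [map_mul, hQZ w hw' c, mul_zero]
  rcases hX.2.mem_or_mem hPQ with h' | h'
  · exact hPX h'
  · exact hQX h'

/-- A finite union of closed sets is closed. [folklore] -/
theorem isClosedG_biUnion {ι : Type*} (s : Finset ι) (Y : ι → Set V)
    (hY : ∀ i ∈ s, M.IsClosedG (Y i)) : M.IsClosedG (⋃ i ∈ s, Y i) := by
  classical
  induction s using Finset.induction_on with
  | empty => simpa using M.isClosedG_empty
  | insert i s hi ih =>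
    rw [Finset.set_biUnion_insert]
    exact (hY i (Finset.mem_insert_self i s)).union M (ih fun k hk => hY k (Finset.mem_insert_of_mem hk))

/-- An irreducible set contained in a finite union of closed sets lies in one of them. [folklore] -/
theorem IsIrred.exists_subset_of_subset_biUnion {ι : Type*} {X : Set V} (hX : M.IsIrred X)
    (s : Finset ι) (Y : ι → Set V) (hY : ∀ i ∈ s, M.IsClosedG (Y i)) (h : X ⊆ ⋃ i ∈ s, Y i) :
    ∃ i ∈ s, X ⊆ Y i := by
  classical
  induction s using Finset.induction_on with
  | empty =>
    simp only [Finset.notMem_empty, iUnion_of_empty, iUnion_empty, subset_empty_iff] at h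
    exact absurd h hX.nonempty.ne_empty
  | insert i s hi ih =>
    rw [Finset.set_biUnion_insert] at h
    have hcl : M.IsClosedG (⋃ j ∈ s, Y j) :=
      M.isClosedG_biUnion s Y fun k hk => hY k (Finset.mem_insert_of_mem hk)
    rcases hX.subset_or_subset M (hY i (Finset.mem_insert_self i s)) hcl h with h' | h'
    · exact ⟨i, Finset.mem_insert_self i s, h'⟩
    · obtain ⟨j, hj, hj'⟩ := ih (fun k hk => hY k (Finset.mem_insert_of_mem hk)) h'
      exact ⟨j, Finset.mem_insert_of_mem hj, hj'⟩

/-- The zero set of a single form, translated: `{w | F_P(w + a) = 0}` is closed. [folklore] -/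
theorem isClosedG_setOf_F_add_eq_zero {P : MvPolynomial (Fin (N + 1)) ℂ} {d : ℕ}
    (hP : P.IsHomogeneous d) (a : V) : M.IsClosedG {w | M.F P (w + a) = 0} := by
  have : {w | M.F P (w + a) = 0} = (-a) +ᵥ M.zeroSet {P} := by
    ext w
    rw [Set.mem_vadd_set]
    constructor
    · intro hw
      refine ⟨w + a, ?_, by simp⟩
      rw [M.mem_zeroSet_iff_of_isHomogeneous (fun Q hQ => ⟨d, by rw [Set.mem_singleton_iff.mp hQ]; exact hP⟩)]
      intro Q hQ
      rw [Set.mem_singleton_iff.mp hQ]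
      exact hw
    · rintro ⟨u, hu, rfl⟩
      rw [M.mem_zeroSet_iff_of_isHomogeneous (fun Q hQ => ⟨d, by rw [Set.mem_singleton_iff.mp hQ]; exact hP⟩)] at hu
      simpa using hu P rfl
  rw [this]
  exact (M.isClosedG_zeroSet _).vadd M (-a)

/-- Translates of irreducible sets are irreducible. [folklore] -/
theorem IsIrred.vadd {X : Set V} (hX : M.IsIrred X) (a : V) : M.IsIrred (a +ᵥ X) := by
  refine ⟨hX.1.vadd M a, (M.isHomogeneous_vanishing _).isPrime_of_homogeneous_mem_or_mem ?_ ?_⟩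
  · intro htop
    have h1 : (1 : MvPolynomial (Fin (N + 1)) ℂ) ∈ M.vanishing (a +ᵥ X) := htop ▸ Submodule.mem_top
    obtain ⟨x, hx⟩ := hX.nonempty
    have := h1 (a +ᵥ x) ⟨x, hx, rfl⟩ 1
    simp at this
  · rintro P Q ⟨d, hPd⟩ ⟨e, hQe⟩ hPQ
    rw [mem_homogeneousSubmodule] at hPd hQe
    rw [M.mem_vanishing_iff_of_isHomogeneous (hPd.mul hQe)] at hPQ
    rw [M.mem_vanishing_iff_of_isHomogeneous hPd, M.mem_vanishing_iff_of_isHomogeneous hQe]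
    -- `X ⊆ {F_P(· + a) = 0} ∪ {F_Q(· + a) = 0}`, two closed sets
    have hsub : X ⊆ {w | M.F P (w + a) = 0} ∪ {w | M.F Q (w + a) = 0} := by
      intro x hx
      have := hPQ (a +ᵥ x) ⟨x, hx, rfl⟩
      rw [F_mul, mul_eq_zero] at this
      simpa [add_comm] using this
    rcases hX.subset_or_subset M (M.isClosedG_setOf_F_add_eq_zero hPd a)
      (M.isClosedG_setOf_F_add_eq_zero hQe a) hsub with h | h
    · left
      rintro w ⟨x, hx, rfl⟩
      simpa [add_comm] using h hx
    · right
      rintro w ⟨x, hx, rfl⟩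
      simpa [add_comm] using h hx

/-! ### Holomorphy of the translation structure in the second argument

The abstract theory only ever uses the laws through `lawAt`/`translForm` and the following
holomorphy (`ZeroEstDerivForms.lean`: derivatives in the translation parameter). -/

/-- The coefficients of the specialised laws `A^α_I(X, Θ(v))` are entire functions of `v`.
[folklore] -/
theorem coeffDifferentiable_lawAt (α : Fin M.nLaw) (I : Fin (N + 1)) :
    CoeffDifferentiable fun v : V => M.lawAt α I v :=
  M.differentiable_coeff_law α I

/-- **The coefficients of the translates `translForm α v Q` of a fixed `Q` are entire functions
of `v`.** [cite: NesterenkoPhilippon2001, Ch. 11 Prop. 3.6 (iv) (proof)] -/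
theorem coeffDifferentiable_translForm (α : Fin M.nLaw) (Q : MvPolynomial (Fin (N + 1)) ℂ) :
    CoeffDifferentiable fun v : V => M.translForm α v Q :=
  coeffDifferentiable_bind₁ (fun I => M.coeffDifferentiable_lawAt α I) Q

end AnalyticGroupModel

end Literature.NumberTheory.Transcendental
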